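import Mathlib
import HarnessLib
import HarnessLib.Audit
import Summits.HodgeConjecture.HodgeConjecture.Theses.RankFourFaces
import Literature.AlgebraicGeometry.HodgeTheory.IsoTransport

/-!
# Line `birth` — BC3 skeleton for the crux `FaceReduction` (stmt-HodgeConjecture-16266)

Route `RankFourFaces` (route-HodgeConjecture-RankFourFaces), crux of rank 3
`FaceReduction : RankFourWeilTransport → CMAbelianHodge` — "rank-four transport already gives the whole
CM sector": Grothendieck's variational Hodge statement for degree-4 classes in smooth projective
families of abelian `4g`-folds with `E = ℚ[T]/(P)`-multiplication (the route's rank-2 crux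
`RankFourWeilTransport`, here the HYPOTHESIS `T`) implies the Hodge conjecture for every complex abelian
variety of CM type (the shared target `CMAbelianHodge`).

THE LINE = the route's own printed proof plan (i) André + (ii) the 2001 lattice theorem + (iii) Deligne's
split rank-4 family + (iv) transport, cut into THREE registered stubs at its three mathematically
independent joints, each typed on the real carriers the route already uses (`Motives.AbelianVariety`,
`pullbackEigenclasses`, `complexBetti`, `IsRationalClass`, `IsOfHodgeType`, `algebraicClasses`,
`IsSmoothProjectiveFamily`, `fiberOver` / `fiberι`), the transport step (iv) being the sorry-free glue:

* **E-CM products.** Throughout, `P ∈ ℤ[T]` is monic of degree `2g`, irreducible over `ℚ`, without real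
  roots and with polynomial complex conjugation (verbatim the hypotheses of `RankFourWeilTransport`), so
  `E = ℚ[T]/(P)` is a CM field of degree `2g`; an **E-CM `g`-fold** is `(B, ψ)` with `dim B = g`,
  `P(ψ) = 0` (`E ⊆ End⁰(B)` with `[E:ℚ] = 2 dim B`: `B` has CM by `E`, of some CM type `Φ ⊂ {ρ : P(ρ)=0}`);
  an **E-CM `r`-product** is `(Y, φ)` with `E`-equivariant projections `π_i : Y ⟶ B_i` (`i : Fin r`)
  onto E-CM `g`-folds forming a product cone (`IsLimit (Fan.mk Y π)`), `dim Y = r·g`, `P(φ) = 0`;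
  its complexified **E-Weil space** `W_E(Y) = (⋀ʳ_E H¹(Y,ℚ)) ⊗ ℂ ⊆ Hʳ(Y(ℂ);ℂ)` is, on the tree's carrier,
  `⨆_{P(ρ)=0} pullbackEigenclasses Y φ r ((x,y) ↦ (x + yρ)ʳ)` (Moonen–Zarhin: `(x·𝟙 + y·φ)^*` acts on
  `⋀ʳ V_ρ` by `(x + yρ)ʳ`, and these characters of `ℕ²` are pairwise distinct from all other
  `∏_σ (x + yσ)^{n_σ}`, so the eigenspace is exactly `⊕_ρ ⋀ʳ V_ρ`); it is **of Weil type** when every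
  class of `W_E(Y)` has Hodge type `(r/2, r/2)` — for an E-CM product this says the CM types of the
  factors add up to the constant `r/2` (Charles–Schnell Lemma 11.5.18), i.e. the multiplicity function is
  BALANCED in the sense of the 2001 lattice `R_g`, and then `(Y, φ)` is of SPLIT Weil type (Prop. 11.5.22).
  The route's FACES `Q = A_a × A_{-a^(i)} × A_{-a^(j)} × A_{a^(ij)}` are exactly such balanced E-CM
  4-products (each place of `E` is hit twice among the four types); PAIRS `A_a × A_{ā}` are the balanced
  2-products (their Weil classes are `(1,1)`-classes).

* `stub_cmProductsReachRankFourFamily : CMProductsReachRankFourFamily` — step (iii), Deligne's family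
  with an ALGEBRAIC anchor and a GLOBAL class, typed to feed `RankFourWeilTransport` literally: every
  rational class `c ∈ W_E(Y)` on an E-CM 4-product of Weil type (`g ≥ 2`) lies in a smooth projective
  family `f : 𝒳 ⟶ S` of relative dimension `4g` over a smooth irreducible base, all of whose fibres are
  `≅ (A', φ')` with `P(φ') = 0`, with `e : 𝒳_{s₁} ≅ Y`, a global class `W ∈ H⁴(𝒳(ℂ);ℂ)` that is rational of
  type `(2,2)` on every fibre and restricts to `e^* c` at `s₁`, and a fibre `s₀` where `W` is algebraic
  (the `ℚ`-split anchor `A₀ ⊗_ℚ E`, `A₀` an abelian surface, where `W_E` lies in the span of the pull-backs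
  `p_μ^*[pt]` of the point class of `A₀` along the homomorphisms `p_μ : A₀ ⊗ E → A₀`, `μ ∈ Λ^∨` — polarisation
  of the quartic `μ ↦ ∧ᵢ(xᵢ ⊗ μ)`, whose values at the eigenvectors `μ = v_σ` span `⊕_σ ⋀⁴W_σ = W_E ⊗ ℂ` — hence
  ALGEBRAIC: Prop. 11.5.23 with "absolute" read "algebraic"; the family is Thm. 11.5.24 over the neat,
  det-1 cover `Γ''\D^sp`, `D^sp ≅ ∏_σ U(2,2)/K`, with the universal abelian scheme pulled back, and `W`
  comes from the theorem of the fixed part since `SU` acts trivially on `⋀⁴_E`). The HARDEST stub (XL: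
  a PEL/Shimura family on real carriers); it is where every clause of the crux's "why it might fail" lives.
* `stub_latticeRankReduction : RankFourCMProductWeilClassesAlgebraic → CMProductWeilClassesAlgebraic` —
  step (ii), the RANK BOUND that is the route's lever: if the rational `(2,2)` E-Weil classes of every
  E-CM 4-product of Weil type are algebraic (`g ≥ 2`), then so are the rational `(k,k)` E-Weil classes of
  every E-CM `2k`-product of Weil type, every `k ≥ 1`, every `g ≥ 1`. Mechanism: the 2001 lattice theorem
  (stockroom `reserve/prior-2001/…/Hodge_WSupersingularLiftingRankFourWeilGeneration_RankFourWeilLattice.lean`,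
  `theoremA` / `exists_nonneg_decomposition` / `algebraic_of_faces`, kernel-checked, `g ≥ 1`): the lattice
  `R_g` of balanced multiplicity functions is generated by pairs and faces with a non-negative
  decomposition `m + u = v`; geometric dictionary `h_pair` (pairs are `(1,1)`: Lefschetz), `h_mul`
  (`L_{u+v} ⊆ L_u ⊠ L_v`: exterior products of algebraic classes), `h_cancel` (`L_{m+u}`, `L_u` algebraic ⇒
  `L_m` algebraic: project `z ∪ pr₂^*(y ∪ θ^{(g-1)|u|})` to `A_m`; the `θ`-power pairs `⋀^{|u|}V_σ` with
  `⋀^{|u|}V_σ̄` non-trivially), `h_zero`; plus isogeny invariance to pass between any E-CM product and the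
  canonical `∏ A_a^{m(a)}`. For `g = 1` and for `k = 1` no rank-4 input is needed (`R_1`, `R_2` are spanned
  by pairs), which is why the hypothesis starts at `g ≥ 2` while the conclusion covers `g ≥ 1`. (L.)
* `stub_andreReduction : CMProductWeilClassesAlgebraic → CMAbelianHodge` — step (i), ANDRÉ 1992 on real
  carriers (Charles–Schnell Thm. 11.5.21 = Markman arXiv:2509.23403 Thm. 1.4): for `A` of CM type, with `E`
  the Galois closure of the compositum of the CM fields of its simple factors (`E = ℚ(θ)`, `P` = minimal
  polynomial of an integral primitive `θ`), `A ⊗_ℚ E ~ ∏ A_{gφ_i}` and every Hodge class on `A` is a sum of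
  pull-backs, along homomorphisms, of rational Hodge classes in `⋀^{2k}_E H¹(Y_α)` of the E-CM
  `2k`-products `Y_α = ∏_{(i,g)∈α} A_{gφ_i}`, which are balanced (of Weil type) whenever the component
  `ξ_α ≠ 0`; pull-backs of algebraic classes are algebraic (`HodgeTheory/AlgebraicClassesPullback`,
  `AbelianVarietyPullbackAlgebraicClasses`) and `HodgeModel` existence supplies the anti-vacuity conjunct
  of `HodgeConjectureFor`. A KNOWN theorem (the route's cite want wi-33292): if it lands as a Literature
  named fact in this geometric form, the stub closes by citing it. (L: the `A ⊗_ℚ E` bookkeeping on real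
  carriers.)
* `FaceReduction_of : Sig.stub_cmProductsReachRankFourFamily → Sig.stub_latticeRankReduction →
  Sig.stub_andreReduction → FaceReduction` (`Sig.stub_*` = the stub statements verbatim, named after the
  stubs so the A12 audit admits them as declared-stub hypotheses) — THE skeleton theorem, a REAL proof
  (axioms `{propext, Classical.choice, Quot.sound}`): given `T : RankFourWeilTransport`, the
  input `RankFourCMProductWeilClassesAlgebraic` of stub B2 holds — take the family of stub A through
  `(Y, c)`, transport algebraicity from the anchor `s₀` to `s₁` by `T`, rewrite `W|_{s₁} = e^* c` and cross
  the isomorphism `e` (`mem_algebraicClasses_map_iff_of_iso`) — then stub B2 gives all ranks and stub B1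
  gives `CMAbelianHodge`. `FaceReduction_of_stubs : FaceReduction` instantiates it with the three stubs
  (the hypothesis-free target the skeleton audit keys on; NOT a proof: `sorryAx` exactly through the stubs).

`sorry` occurs ONLY in the three `stub_*` theorems (lean check: rc 0, sorries = 3 = stubs, zero elsewhere).
Honest status: stubs B1 and B2 and the statement `RankFourCMProductWeilClassesAlgebraic` are, like every
pointwise statement in this area, classically implied by the Hodge conjecture (fibrewise; recorded
sorry-free in §4), and stub B1 is a published theorem; none of the three gives the crux or the summit
cheaply — BC3 probes `stub → FaceReduction` and `stub → HodgeConjecture` by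
`first | exact? | simpa | aesop`, by `simpa [stub]`, `unfold stub; simpa`, and by `exact?` / `aesop` /
`tauto` after unfolding stub AND target all FAIL (18/18 + 18/18, seat folder `bc/probe_stubs_to_*.lean`):
stub A manufactures families but proves nothing algebraic, stub B2 needs the rank-4 input that only
A + `T` produce, stub B1 needs all ranks. §4 also records that the route's SUPPORT item
`RankFourWeilClasses` (stmt-HodgeConjecture-16268, all discriminants) implies the rank-4 input outright,
so a proof of 16268 replaces stub A + `T` in this line, and that `T` is used exactly once, at E-CM
products of Weil type (split), never at a non-split or non-CM point.

Disproof used: `Cruxes/FaceReduction/` had NO workfile before this one (`ledger crux ls`: no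
`Disproof.lean`, no `_false_without_` theorem, no landed `Theorems/FaceReduction/Negative/*`), so there is
no obstruction hypothesis to honour yet; the line uses the crux's only hypothesis `T` at the glue step
(`rankFourCMProductWeilClassesAlgebraic_of_reach_of_transport`). Negatives index
(`ledger negatives --problem HodgeConjecture`, 3 entries: MilnorKExponential symbol lift, DerivedTorelliFermat
K3 multisets, ELineTransport 22×22 lattice matrices): no stub is an instance. Evidence on the item read:
the grounder note (André = Markman Thm 1.4 verbatim; cite wants wi-33292/33293), the route-review objection
H3 (FaceReduction is really L/XL because of the PEL family — reflected: that family is isolated as stub A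
and rated XL), idea-node cards `fermat-type-faces-are-free` (faces over `ℚ(ζ₇)`, `ℚ(ζ₉)` already algebraic
by Aoki/Shioda — a special case of the INPUT of stub B2, no transport) and the `g = 3` addendum.

References: [Andre1992HodgeCM]; [CharlesSchnell2014Notes] §11.5.5–11.5.7 (Lemma 11.5.18, Prop. 11.5.20,
Thm. 11.5.21, Prop. 11.5.22, Prop. 11.5.23, Thm. 11.5.24 — READ this session, book
`cattani2014-hodge-theory-princeton-mathematical-notes-49` pp. 509–516); [Deligne1982HodgeCycles] §4–5;
[MoonenZarhin1998WeilClasses]; [vanGeemen1994HodgeAV] 4.8–4.11; Markman arXiv:2509.23403 Thm. 1.4, §12.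
-/

set_option linter.dupNamespace false
set_option linter.unusedVariables false

namespace Summit.HodgeConjecture.HodgeConjecture.Cruxes.FaceReduction.Birth

-- `≫` (composition) is a SCOPED notation of `CategoryTheory` in this Mathlib: a prover restating a stub
-- statement verbatim needs `open CategoryTheory` (or `CategoryTheory.CategoryStruct.comp`) in scope.
open CategoryTheory

-- The stub STATEMENTS below are written FULLY QUALIFIED on purpose: a prover restates their text verbatim in a
-- Theorems file importing only the RankFourFaces route (+ Mathlib/Literature) and proves
-- `theorem stub_<name> : <the Prop text>` (`ledger propose … --supports stmt-HodgeConjecture-16266`).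

/-- **Statement of stub A — E-CM 4-products of Weil type reach an algebraic anchor inside a smooth
projective rank-four E-family.** For `g ≥ 2`, `P` a CM polynomial of degree `2g` (hypotheses verbatim
those of `RankFourWeilTransport`), `(B_i, ψ_i)_{i<4}` E-CM `g`-folds, `(Y, φ, π)` their E-equivariant
product (`IsLimit (Fan.mk Y π)`, `dim Y = 4g`, smooth projective, `P(φ) = 0`) OF WEIL TYPE (every class
of the E-Weil space `W_E(Y) = ⨆_{P(ρ)=0} pullbackEigenclasses Y φ 4 ((x,y) ↦ (x+yρ)⁴)` has Hodge type
`(2,2)`), and every RATIONAL `c ∈ W_E(Y)`: there are a smooth projective family `f : 𝒳 ⟶ S` of relative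
dimension `4g` with `S` irreducible and smooth over `ℂ`, all of whose fibres are `≅ (A', φ')` with
`dim A' = 4g`, `P(φ') = 0`; a point `s₁` with `e : 𝒳_{s₁} ≅ Y`; a global class `W ∈ H⁴(𝒳(ℂ);ℂ)` rational
of type `(2,2)` on every fibre with `W|_{s₁} = e^* c`; and a point `s₀` with `W|_{s₀}` ALGEBRAIC — i.e.
literally the hypotheses of `RankFourWeilTransport` plus an anchor. (Charles–Schnell Prop. 11.5.22,
Thm. 11.5.24, Prop. 11.5.23, theorem of the fixed part.)
[cite: CharlesSchnell2014Notes, Prop. 11.5.22, Prop. 11.5.23 and Thm. 11.5.24] -/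
def CMProductsReachRankFourFamily : Prop :=
  ∀ (g : ℕ), 2 ≤ g → ∀ (P : Polynomial ℤ), P.Monic → P.natDegree = 2 * g →
    Irreducible (P.map (Int.castRingHom ℚ)) →
    (∀ ρ : ℂ, Polynomial.eval₂ (Int.castRingHom ℂ) ρ P = 0 → ρ.im ≠ 0) →
    (∃ Q : Polynomial ℚ, ∀ ρ : ℂ, Polynomial.eval₂ (Int.castRingHom ℂ) ρ P = 0 →
      Polynomial.aeval ρ Q = (starRingEnd ℂ) ρ) →
    ∀ (B : Fin 4 → Literature.AlgebraicGeometry.Motives.AbelianVariety ℂ) (ψ : ∀ i, B i ⟶ B i),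
      (∀ i, (B i).dim = g) →
      (∀ i, Polynomial.eval₂ (Int.castRingHom (CategoryTheory.End (B i)))
        (ψ i : CategoryTheory.End (B i)) P = 0) →
    ∀ (Y : Literature.AlgebraicGeometry.Motives.AbelianVariety ℂ) (φ : Y ⟶ Y) (π : ∀ i, Y ⟶ B i),
      (∀ i, π i ≫ ψ i = φ ≫ π i) →
      Nonempty (CategoryTheory.Limits.IsLimit (CategoryTheory.Limits.Fan.mk Y π)) →
      Y.dim = 4 * g →
      Literature.AlgebraicGeometry.Motives.IsSmoothProjective (4 * g) Y.X →
      Polynomial.eval₂ (Int.castRingHom (CategoryTheory.End Y)) (φ : CategoryTheory.End Y) P = 0 →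
      (∀ c ∈ (⨆ ρ ∈ {ρ : ℂ | Polynomial.eval₂ (Int.castRingHom ℂ) ρ P = 0},
          Literature.AlgebraicGeometry.HodgeTheory.pullbackEigenclasses Y φ 4
            (fun x y => ((x : ℂ) + (y : ℂ) * ρ) ^ 4)),
        Literature.AlgebraicGeometry.HodgeTheory.IsOfHodgeType (4 * g) Y.X 4 2 2 c) →
    ∀ c : Literature.AlgebraicGeometry.HodgeTheory.complexBetti Y.X 4,
      Literature.AlgebraicGeometry.HodgeTheory.IsRationalClass c →
      c ∈ (⨆ ρ ∈ {ρ : ℂ | Polynomial.eval₂ (Int.castRingHom ℂ) ρ P = 0},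
          Literature.AlgebraicGeometry.HodgeTheory.pullbackEigenclasses Y φ 4
            (fun x y => ((x : ℂ) + (y : ℂ) * ρ) ^ 4)) →
      ∃ (𝒳 S : Literature.AlgebraicGeometry.Motives.SchemeOver ℂ) (f : 𝒳 ⟶ S),
        Literature.AlgebraicGeometry.Motives.IsSmoothProjectiveFamily f (4 * g) ∧
        IrreducibleSpace S.left ∧ AlgebraicGeometry.Smooth S.hom ∧
        (∀ s : Literature.AlgebraicGeometry.Motives.ComplexPoints S,
          ∃ (A' : Literature.AlgebraicGeometry.Motives.AbelianVariety ℂ) (φ' : A' ⟶ A'),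
            A'.dim = 4 * g ∧
            Polynomial.eval₂ (Int.castRingHom (CategoryTheory.End A'))
              (φ' : CategoryTheory.End A') P = 0 ∧
            Nonempty (A'.X ≅ Literature.AlgebraicGeometry.Motives.fiberOver f s)) ∧
        ∃ (s₁ : Literature.AlgebraicGeometry.Motives.ComplexPoints S)
          (e : Literature.AlgebraicGeometry.Motives.fiberOver f s₁ ≅ Y.X)
          (W : Literature.AlgebraicGeometry.HodgeTheory.complexBetti 𝒳 4),
          (∀ s : Literature.AlgebraicGeometry.Motives.ComplexPoints S,
            Literature.AlgebraicGeometry.HodgeTheory.IsRationalClass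
                (Literature.AlgebraicGeometry.HodgeTheory.complexBetti.map
                  (Literature.AlgebraicGeometry.Motives.fiberι f s) 4 W) ∧
              Literature.AlgebraicGeometry.HodgeTheory.IsOfHodgeType (4 * g)
                (Literature.AlgebraicGeometry.Motives.fiberOver f s) 4 2 2
                (Literature.AlgebraicGeometry.HodgeTheory.complexBetti.map
                  (Literature.AlgebraicGeometry.Motives.fiberι f s) 4 W)) ∧
          Literature.AlgebraicGeometry.HodgeTheory.complexBetti.map
              (Literature.AlgebraicGeometry.Motives.fiberι f s₁) 4 W =
            Literature.AlgebraicGeometry.HodgeTheory.complexBetti.map e.hom 4 c ∧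
          ∃ s₀ : Literature.AlgebraicGeometry.Motives.ComplexPoints S,
            Literature.AlgebraicGeometry.HodgeTheory.complexBetti.map
                (Literature.AlgebraicGeometry.Motives.fiberι f s₀) 4 W ∈
              Literature.AlgebraicGeometry.HodgeTheory.algebraicClasses
                (Literature.AlgebraicGeometry.Motives.fiberOver f s₀) 2

/-- **Statement `B⁴` — rational `(2,2)` E-Weil classes on E-CM 4-products of Weil type are algebraic**
(`g ≥ 2`; same data as in `CMProductsReachRankFourFamily`). The POINTWISE statement that stub A +
`RankFourWeilTransport` deliver (`rankFourCMProductWeilClassesAlgebraic_of_reach_of_transport`, §4) and the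
hypothesis of stub B2; the faces `A_a × A_{-a^(i)} × A_{-a^(j)} × A_{a^(ij)}` of the 2001 lattice are
instances. Weaker than the route's support item `RankFourWeilClasses` (stmt-HodgeConjecture-16268: all
rank-4 E-Weil classes, all discriminants), which implies it outright (§4); implied by the Hodge
conjecture fibrewise (§4). [cite: MoonenZarhin1998WeilClasses, §2] -/
def RankFourCMProductWeilClassesAlgebraic : Prop :=
  ∀ (g : ℕ), 2 ≤ g → ∀ (P : Polynomial ℤ), P.Monic → P.natDegree = 2 * g →
    Irreducible (P.map (Int.castRingHom ℚ)) →
    (∀ ρ : ℂ, Polynomial.eval₂ (Int.castRingHom ℂ) ρ P = 0 → ρ.im ≠ 0) →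
    (∃ Q : Polynomial ℚ, ∀ ρ : ℂ, Polynomial.eval₂ (Int.castRingHom ℂ) ρ P = 0 →
      Polynomial.aeval ρ Q = (starRingEnd ℂ) ρ) →
    ∀ (B : Fin 4 → Literature.AlgebraicGeometry.Motives.AbelianVariety ℂ) (ψ : ∀ i, B i ⟶ B i),
      (∀ i, (B i).dim = g) →
      (∀ i, Polynomial.eval₂ (Int.castRingHom (CategoryTheory.End (B i)))
        (ψ i : CategoryTheory.End (B i)) P = 0) →
    ∀ (Y : Literature.AlgebraicGeometry.Motives.AbelianVariety ℂ) (φ : Y ⟶ Y) (π : ∀ i, Y ⟶ B i),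
      (∀ i, π i ≫ ψ i = φ ≫ π i) →
      Nonempty (CategoryTheory.Limits.IsLimit (CategoryTheory.Limits.Fan.mk Y π)) →
      Y.dim = 4 * g →
      Literature.AlgebraicGeometry.Motives.IsSmoothProjective (4 * g) Y.X →
      Polynomial.eval₂ (Int.castRingHom (CategoryTheory.End Y)) (φ : CategoryTheory.End Y) P = 0 →
      (∀ c ∈ (⨆ ρ ∈ {ρ : ℂ | Polynomial.eval₂ (Int.castRingHom ℂ) ρ P = 0},
          Literature.AlgebraicGeometry.HodgeTheory.pullbackEigenclasses Y φ 4
            (fun x y => ((x : ℂ) + (y : ℂ) * ρ) ^ 4)),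
        Literature.AlgebraicGeometry.HodgeTheory.IsOfHodgeType (4 * g) Y.X 4 2 2 c) →
    ∀ c : Literature.AlgebraicGeometry.HodgeTheory.complexBetti Y.X 4,
      Literature.AlgebraicGeometry.HodgeTheory.IsRationalClass c →
      Literature.AlgebraicGeometry.HodgeTheory.IsOfHodgeType (4 * g) Y.X 4 2 2 c →
      c ∈ (⨆ ρ ∈ {ρ : ℂ | Polynomial.eval₂ (Int.castRingHom ℂ) ρ P = 0},
          Literature.AlgebraicGeometry.HodgeTheory.pullbackEigenclasses Y φ 4
            (fun x y => ((x : ℂ) + (y : ℂ) * ρ) ^ 4)) →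
      c ∈ Literature.AlgebraicGeometry.HodgeTheory.algebraicClasses Y.X 2

/-- **Statement `B^∞` — rational `(k,k)` E-Weil classes on E-CM `2k`-products of Weil type are
algebraic, every `k ≥ 1`, every CM polynomial `P` of degree `2g`, `g ≥ 1`** (E-Weil space in rank `2k`:
`⨆_{P(ρ)=0} pullbackEigenclasses Y φ (2k) ((x,y) ↦ (x+yρ)^{2k})`; Weil type: all its classes are `(k,k)`).
Conclusion of stub B2 (the rank bound) and hypothesis of stub B1 (exactly the input André's theorem
consumes: split Weil classes on the products `∏_{(i,g)∈α} A_{gφ_i}`); implied by the Hodge conjecture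
fibrewise (§4). [cite: Andre1992HodgeCM, Théorème] -/
def CMProductWeilClassesAlgebraic : Prop :=
  ∀ (g : ℕ), 1 ≤ g → ∀ (P : Polynomial ℤ), P.Monic → P.natDegree = 2 * g →
    Irreducible (P.map (Int.castRingHom ℚ)) →
    (∀ ρ : ℂ, Polynomial.eval₂ (Int.castRingHom ℂ) ρ P = 0 → ρ.im ≠ 0) →
    (∃ Q : Polynomial ℚ, ∀ ρ : ℂ, Polynomial.eval₂ (Int.castRingHom ℂ) ρ P = 0 →
      Polynomial.aeval ρ Q = (starRingEnd ℂ) ρ) →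
    ∀ (k : ℕ), 1 ≤ k →
    ∀ (B : Fin (2 * k) → Literature.AlgebraicGeometry.Motives.AbelianVariety ℂ) (ψ : ∀ i, B i ⟶ B i),
      (∀ i, (B i).dim = g) →
      (∀ i, Polynomial.eval₂ (Int.castRingHom (CategoryTheory.End (B i)))
        (ψ i : CategoryTheory.End (B i)) P = 0) →
    ∀ (Y : Literature.AlgebraicGeometry.Motives.AbelianVariety ℂ) (φ : Y ⟶ Y) (π : ∀ i, Y ⟶ B i),
      (∀ i, π i ≫ ψ i = φ ≫ π i) →
      Nonempty (CategoryTheory.Limits.IsLimit (CategoryTheory.Limits.Fan.mk Y π)) →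
      Y.dim = 2 * k * g →
      Literature.AlgebraicGeometry.Motives.IsSmoothProjective (2 * k * g) Y.X →
      Polynomial.eval₂ (Int.castRingHom (CategoryTheory.End Y)) (φ : CategoryTheory.End Y) P = 0 →
      (∀ c ∈ (⨆ ρ ∈ {ρ : ℂ | Polynomial.eval₂ (Int.castRingHom ℂ) ρ P = 0},
          Literature.AlgebraicGeometry.HodgeTheory.pullbackEigenclasses Y φ (2 * k)
            (fun x y => ((x : ℂ) + (y : ℂ) * ρ) ^ (2 * k))),
        Literature.AlgebraicGeometry.HodgeTheory.IsOfHodgeType (2 * k * g) Y.X (2 * k) k k c) →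
    ∀ c : Literature.AlgebraicGeometry.HodgeTheory.complexBetti Y.X (2 * k),
      Literature.AlgebraicGeometry.HodgeTheory.IsRationalClass c →
      Literature.AlgebraicGeometry.HodgeTheory.IsOfHodgeType (2 * k * g) Y.X (2 * k) k k c →
      c ∈ (⨆ ρ ∈ {ρ : ℂ | Polynomial.eval₂ (Int.castRingHom ℂ) ρ P = 0},
          Literature.AlgebraicGeometry.HodgeTheory.pullbackEigenclasses Y φ (2 * k)
            (fun x y => ((x : ℂ) + (y : ℂ) * ρ) ^ (2 * k))) →
      c ∈ Literature.AlgebraicGeometry.HodgeTheory.algebraicClasses Y.X k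

/-! ## The registered stub SIGNATURES, named after the stubs

`Sig.stub_<name>` is, verbatim, the statement of `theorem stub_<name>` below (definitionally: `Iff.rfl`).
They exist only so that the skeleton theorem `FaceReduction_of` takes its three hypotheses BY THE STUBS'
NAMES — the A12 skeleton audit (`#h21_check_skeleton`) admits a `Prop` hypothesis of the skeleton theorem
iff its head constant is a registered obligation or is named like a declared stub; the stub theorems keep
their expanded, informative signatures (those are what `ledger skeleton check` registers). -/

namespace Sig

/-- Signature of `stub_cmProductsReachRankFourFamily` (= `CMProductsReachRankFourFamily`). [folklore] -/
abbrev stub_cmProductsReachRankFourFamily : Prop :=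
  CMProductsReachRankFourFamily

/-- Signature of `stub_latticeRankReduction` (= `B⁴ → B^∞`, the rank bound). [folklore] -/
abbrev stub_latticeRankReduction : Prop :=
  RankFourCMProductWeilClassesAlgebraic → CMProductWeilClassesAlgebraic

/-- Signature of `stub_andreReduction` (= `B^∞ → CMAbelianHodge`, André). [folklore] -/
abbrev stub_andreReduction : Prop :=
  CMProductWeilClassesAlgebraic → Summit.HodgeConjecture.HodgeConjecture.Theses.RankFourFaces.CMAbelianHodge

end Sig

/-! ## The three registered stubs (`sorry` lives ONLY here) -/

/-- **Stub A — `CMProductsReachRankFourFamily`** (statement and mechanism: the docstring of the Prop and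
the module docstring). Deligne's connected split rank-4 unitary family through an E-CM 4-product of Weil
type, over a neat det-1 level so that the base is smooth and `⋀⁴_E` is monodromy-invariant, with the
universal abelian scheme (smooth projective total space), a global class from the theorem of the fixed
part, and the `ℚ`-split anchor `A₀ ⊗_ℚ E` whose E-Weil classes lie in the span of the pull-backs of the
point class of the abelian surface `A₀` along the homomorphisms `p_μ : A₀ ⊗ E → A₀` (polarisation of the
quartic `μ ↦ ∧ᵢ(xᵢ ⊗ μ)`), hence are ALGEBRAIC. Why plausibly true: Charles–Schnell Prop. 11.5.22 (balanced CM
products are of split Weil type), Thm. 11.5.24 (the family, (a)–(c)), Prop. 11.5.23 (the anchor), Deligne's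
théorème de la partie fixe; integrality of `φ'` on every fibre because the lattice `H¹(Y,ℤ)` is
`ℤ[φ]`-stable and is the fixed lattice of `D^sp`. Why it might fail: exactly the crux's recorded risk —
ONE smooth irreducible base, smooth projective total space, `P(φ') = 0` integrally on every fibre, a
GLOBAL degree-4 class through face and anchor (neat level, det-1 cover, invariant cycles on a non-proper
total space) — all on real carriers the tree does not yet have for PEL families. Size: XL (hardest stub).
[cite: CharlesSchnell2014Notes, Prop. 11.5.22, Prop. 11.5.23 and Thm. 11.5.24] -/
theorem stub_cmProductsReachRankFourFamily : CMProductsReachRankFourFamily := by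
  sorry

/-- **Stub B2 — the rank bound (2001 lattice theorem, geometric form).** If the rational `(2,2)`
E-Weil classes of E-CM 4-products of Weil type are algebraic (`g ≥ 2`), then the rational `(k,k)` E-Weil
classes of E-CM `2k`-products of Weil type are algebraic for every `k ≥ 1` and every `g ≥ 1`. Why
plausibly true: the lattice `R_g` of balanced multiplicity functions on the `2^g` CM types of `E` is
generated by pairs and faces with a non-negative decomposition `m + u = v` (stockroom
`Hodge_WSupersingularLiftingRankFourWeilGeneration_RankFourWeilLattice.lean`: `theoremA`,
`exists_nonneg_decomposition`, `algebraic_of_faces` — kernel-checked for every `g ≥ 1`, any CM field, the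
Galois hypothesis of the 2001 paper being used only in André's step); the abstract `Alg` predicate of
`algebraic_of_faces` is instantiated by "the E-line `L_m = ⋀^{|m|}_E H¹(∏ A_a^{m(a)})` consists of
algebraic classes", with `h_pair` = Lefschetz `(1,1)`, `h_mul` = exterior product
(`L_{u+v} ⊆ L_u ⊠ L_v`, `HodgeTheory/AlgebraicClassesExteriorProduct`), `h_cancel` = projection formula with
the `θ`-power pairing (module docstring), `h_face` = the hypothesis, and isogeny invariance
(`WeilClassesIsogenyDescent`-type lemmas) to move between an arbitrary E-CM product and the canonical one.
Why it might fail: `h_cancel` needs the pairing `⋀^{|u|}V_σ × ⋀^{|u|}V_σ̄ ∪ θ^{(g-1)|u|} → H^{top}` to be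
non-zero on EVERY `σ`-line (a sign/positivity computation with the polarisation), and the identification of
the real-carrier eigenclass space with `⋀_E` uses `H^*(Y) = ⋀^* H¹` for abelian varieties
(`AbelianVarietyCohomologyExteriorH1`). Size: L. [folklore] -/
theorem stub_latticeRankReduction :
    RankFourCMProductWeilClassesAlgebraic → CMProductWeilClassesAlgebraic := by
  sorry

/-- **Stub B1 — André's theorem on real carriers.** If the rational `(k,k)` E-Weil classes of all E-CM
`2k`-products of Weil type are algebraic (all CM polynomials `P`, all `g ≥ 1`, `k ≥ 1`), then the Hodge
conjecture holds for every complex abelian variety of CM type (`CMAbelianHodge`, verbatim the route decl).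
Why plausibly true: it is André 1992 (Charles–Schnell Thm. 11.5.21; Markman arXiv:2509.23403 Thm. 1.4):
with `E` the Galois closure of the compositum of the CM fields of the simple factors of `A`, every Hodge
class on `A` is a sum of pull-backs along homomorphisms `A → Y_α` of rational Hodge classes in
`⋀^{2k}_E H¹(Y_α)`, `Y_α` a product of `2k` abelian `g`-folds `A_{gφ_i}` with CM by `E` (realised with
`O_E`-action, so `P(ψ) = 0` for the minimal polynomial `P` of an integral primitive element), balanced
whenever the component is non-zero (hence of Weil type, Lemma 11.5.18); pull-backs of algebraic classes
are algebraic; `Nonempty (HodgeModel _ A.X)` from Hodge-model existence. Why it might fail: only in the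
plumbing — the passage `(⋀^{2k}_ℚ V) ⊗ E ≅ ⋀^{2k}_E (V ⊗ E)` must be realised by correspondences between
`A`, `A^{2g}` and the quotients `Y_α` on the tree's carriers. Size: L (known theorem; closes by citation
if the cite want wi-33292 lands in this geometric form). [cite: Andre1992HodgeCM, Théorème] -/
theorem stub_andreReduction :
    CMProductWeilClassesAlgebraic →
      Summit.HodgeConjecture.HodgeConjecture.Theses.RankFourFaces.CMAbelianHodge := by
  sorry

/-! ## The composition (sorry-free): the transport step and the skeleton theorem -/

/-- **The glue = step (iv) of the route's plan, isolated**: stub A's families + the crux's hypothesis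
`RankFourWeilTransport` give the rank-4 input `B⁴` of stub B2. Real proof: take the family of stub A
through `(Y, c)`; `T` transports algebraicity from the anchor `s₀` to every fibre, in particular to `s₁`;
rewrite `W|_{s₁} = e^* c` and cross the isomorphism `e : 𝒳_{s₁} ≅ Y`
(`mem_algebraicClasses_map_iff_of_iso`). This is the ONLY place the line uses `T`, and it uses it only at
E-CM products of Weil type (split points). [folklore] -/
theorem rankFourCMProductWeilClassesAlgebraic_of_reach_of_transport
    (hReach : CMProductsReachRankFourFamily)
    (hT : Summit.HodgeConjecture.HodgeConjecture.Theses.RankFourFaces.RankFourWeilTransport) :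
    RankFourCMProductWeilClassesAlgebraic := by
  intro g hg P hP₁ hP₂ hP₃ hP₄ hP₅ B ψ hBdim hψ Y φ π hπ hprod hYdim hYsp hφ hWeil c hc_rat hc_hodge hc_W
  obtain ⟨𝒳, S, f, hf, hirr, hsm, hfib, s₁, e, W, hW, hWs₁, s₀, hs₀⟩ :=
    hReach g hg P hP₁ hP₂ hP₃ hP₄ hP₅ B ψ hBdim hψ Y φ π hπ hprod hYdim hYsp hφ hWeil c hc_rat hc_W
  have h := hT g hg P hP₁ hP₂ hP₃ hP₄ hP₅ f hf hirr hsm hfib W hW ⟨s₀, hs₀⟩ s₁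
  rw [hWs₁] at h
  exact (Literature.AlgebraicGeometry.HodgeTheory.mem_algebraicClasses_map_iff_of_iso (p := 2) e).1 h

/-- **THE SKELETON THEOREM** (BC3 shape `stub-A-sig → stub-B2-sig → stub-B1-sig → crux`, the three
signatures written by the stubs' names `Sig.stub_*`, conclusion the route decl
`Summit.HodgeConjecture.HodgeConjecture.Theses.RankFourFaces.FaceReduction` BY NAME). Real proof, no `sorry`: `FaceReduction` unfolds to `RankFourWeilTransport → CMAbelianHodge`; given `T`, the
transport step gives `B⁴`, stub B2 lifts it to all ranks `B^∞`, stub B1 (André) turns `B^∞` into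
`CMAbelianHodge`. Axioms: `{propext, Classical.choice, Quot.sound}`. [folklore] -/
theorem FaceReduction_of :
    Sig.stub_cmProductsReachRankFourFamily → Sig.stub_latticeRankReduction → Sig.stub_andreReduction →
      Summit.HodgeConjecture.HodgeConjecture.Theses.RankFourFaces.FaceReduction :=
  fun hReach hLattice hAndre hT =>
    hAndre (hLattice (rankFourCMProductWeilClassesAlgebraic_of_reach_of_transport hReach hT))

/-- The three `Sig` names are the stub statements verbatim (definitional sanity, `Iff.rfl`). [folklore] -/
example : (Sig.stub_cmProductsReachRankFourFamily ↔ CMProductsReachRankFourFamily) ∧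
    (Sig.stub_latticeRankReduction ↔
      (RankFourCMProductWeilClassesAlgebraic → CMProductWeilClassesAlgebraic)) ∧
    (Sig.stub_andreReduction ↔
      (CMProductWeilClassesAlgebraic →
        Summit.HodgeConjecture.HodgeConjecture.Theses.RankFourFaces.CMAbelianHodge)) :=
  ⟨Iff.rfl, Iff.rfl, Iff.rfl⟩

/-- **Registered target of the skeleton** — the crux BY NAME with NO hypotheses: `FaceReduction_of`
applied to the three declared stubs (the crux modulo exactly the registered stubs; `#print axioms` reaches
`sorryAx` precisely through the three `stub_*`, so it is NOT a proof of the item and closes nothing until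
the stubs land). [folklore] -/
theorem FaceReduction_of_stubs :
    Summit.HodgeConjecture.HodgeConjecture.Theses.RankFourFaces.FaceReduction :=
  FaceReduction_of stub_cmProductsReachRankFourFamily stub_latticeRankReduction stub_andreReduction

/-! ## §4 Recorded relations (sorry-free): where the statements sit -/

/-- The route's SUPPORT item `RankFourWeilClasses` (stmt-HodgeConjecture-16268: every rational `(2,2)`
rank-4 E-Weil class, all discriminants, no product structure) implies the rank-4 input `B⁴` of stub B2
outright (drop the product and Weil-type hypotheses). So a proof of 16268 replaces stub A + `T` in this
line. [folklore] -/
theorem rankFourCMProductWeilClassesAlgebraic_of_rankFourWeilClasses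
    (h : Summit.HodgeConjecture.HodgeConjecture.Theses.RankFourFaces.RankFourWeilClasses) :
    RankFourCMProductWeilClassesAlgebraic :=
  fun g hg P hP₁ hP₂ hP₃ hP₄ hP₅ _B _ψ _ _ Y φ _π _ _ hYdim hYsp hφ _ c hc hpp hcW =>
    h g hg P hP₁ hP₂ hP₃ hP₄ hP₅ Y φ hYdim hYsp hφ c hc hpp hcW

/-- `S → B⁴` (recorded converse probe): the rank-4 input is a CONSEQUENCE of the summit, fibrewise
(`HodgeConjectureFor n X` is `Nonempty (HodgeModel n X) ∧` "every rational `(p,p)`-class is algebraic").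
[folklore] -/
theorem rankFourCMProductWeilClassesAlgebraic_of_hodgeConjecture (h : _root_.HodgeConjecture) :
    RankFourCMProductWeilClassesAlgebraic :=
  fun _g _ _P _ _ _ _ _ _B _ψ _ _ Y _φ _π _ _ _ hYsp _ _ c hc hpp _ => (h hYsp).2 2 c hc hpp

/-- `S → B^∞` (recorded converse probe): likewise for every rank. [folklore] -/
theorem cmProductWeilClassesAlgebraic_of_hodgeConjecture (h : _root_.HodgeConjecture) :
    CMProductWeilClassesAlgebraic :=
  fun _g _ _P _ _ _ _ _ k _ _B _ψ _ _ Y _φ _π _ _ _ hYsp _ _ c hc hpp _ => (h hYsp).2 k c hc hpp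

/-- `S → crux` (recorded converse probe): the crux is a CONSEQUENCE of the summit (`T` unused); it is used
TOWARD the summit through the route's `closes` (case `X = A.X`). [folklore] -/
example (h : _root_.HodgeConjecture) :
    Summit.HodgeConjecture.HodgeConjecture.Theses.RankFourFaces.FaceReduction :=
  fun _ A hA _ => h hA

end Summit.HodgeConjecture.HodgeConjecture.Cruxes.FaceReduction.Birth
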